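import Summits.BirchSwinnertonDyer.Rank1Residual.Partition.MainConjecturesAnticyclotomic
import Summits.BirchSwinnertonDyer.Rank1Residual.X11b.BDPRouteManin
import Literature.NumberTheory.EllipticCurves.CyclotomicIwasawaMainTheoremIrreducibleBaseChangeProofs
import Literature.NumberTheory.EllipticCurves.JetchevSkinnerWan2017.RamifiedPrimeOfSemistable
import Literature.NumberTheory.QuadraticFields.FundamentalDiscriminant
import HarnessLib

/-!
# Row C3 at CLASS level: STEP L (anticyclotomic main conjecture + control + BDP, as typed) +
# Gross–Zagier + Kolyvagin + the cyclotomic main conjecture of the twist (typed) ⇒ BSD(E,p) for every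
# rank-one semistable pair at a good ordinary `p ≥ 5` with `p ∤ ∏ c_ℓ` — the field choice and the
# twist transports DISCHARGED (cell `b2b-bsdres`, GLUE seat; companion of
# `Partition/MainConjecturesAnticyclotomic.lean`)

HONEST FRAMING (cell `b2b-bsdres`, run/shared/lean/b2b/bsd-rank1-residual/, verbatim in every
file): the goal of the cell is to DELETE the COMBINATION-SHAPED residual classes of the
Birch–Swinnerton-Dyer formula for ALL analytic-rank `≤ 1` elliptic curves over `ℚ` — "full BSD
formula for every rank `≤ 1` curve in class `C`" assembled STRICTLY from published theorems — so
that the rank-`≤ 1` remainder becomes exactly the CONSTRUCTION-SHAPED classes, which are TYPED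
(missing-input `Prop`s), NOT attempted. This is not "finishing BSD". NEW WORK of the cell
(bookkeeping over decls already in the tree), hence under `Summits/`; NO named fact, NO definition.

## What this file does

`Partition/MainConjecturesAnticyclotomic.lean` proved the printed route of row C3 (Jetchev–Skinner–Wan,
Camb. J. Math. 5 (2017) Thm. 1.2.1, §7.4.1) AT A HEEGNER DATUM:
`X11b.bsdp_rankOne_of_indexLowerBoundAt_of_goodOrd_twist` takes the auxiliary imaginary quadratic
field `K`, the Manin-unit parametrisation datum, the Heegner point, and a globally minimal model `Wd`
of the twist `E^{(d_K)}` WITH its five side conditions (good ordinary at `p`, `Wd[p]` irreducible, a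
(ram) prime, `ord_p ∏ c_ℓ(Wd) = ord_p ∏ c_ℓ(W)`, `ord_p u(Cd) = 0`) as explicit binders. This file
discharges all of them at CLASS level, exactly as the multr1 seats did for class X11b at `p ∥ N`
(`X11b/BDPRouteStatement.lean` … `X11b/BDPRouteManin.lean`), now at a GOOD ordinary prime:

* the field: Friedberg–Hoffstein with `p` split (`friedbergHoffstein_exists_heegnerField_split_twist_ne_zero`,
  JSW §7.4.1 conditions (a)–(d)), `|d_K| > 4` so `#𝓞_K^× = 2` is prime to `p`;
* the datum: `X11b.exists_maninDatum_of_good` — modularity, Mazur 1978 Cor. 4.1 (`p² ∤ N` because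
  `p ∤ N`), the Néron mapping property, CM theory (the multr1 theorem
  `X11b.exists_modularParametrizationData_not_dvd` needs only `p² ∤ N`);
* (ram) for `E` itself: Ribet's level-lowering remark of JSW §7.4 (the tree's named fact
  `JetchevSkinnerWan2017.sec74_exists_ramifiedPrime_of_semistable`, binder `hRib`);
* the transports to the minimal twist model: (irr) `X11b.hasIrreducibleModPGaloisRep_twist_model`,
  (ram) `X11b.ram_twist_of_heegner`, Tamagawa `X11b.padicValNat_tamagawaProduct_twist_of_heegner`
  (all three reduction-type-agnostic at `p`, multr1), and — NEW here, the two that multr1 proved only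
  at a multiplicative `p` — good ORDINARY reduction of the twist model (`X11b.goodOrd_twist_model`:
  `a_p(E^{(d)}) = (d/p) a_p(E)` for `p ∤ 2d`, Knapp Prop. 12.10, through the tree's
  `isOrdinaryAt_of_smul_eq_quadraticTwist`, with the even fundamental discriminants `d_K = 4m`
  reduced to the squarefree `m` by `W^{(4m)} ≅ W^{(m)}`) and the unit side condition
  (`X11b.padicValRat_u_eq_zero_of_twist_good`: both minimal discriminants are `p`-units at a good
  `p`, and `Δ(Wd) = u⁻¹² d_K⁶ Δ(W)` with `p ∤ d_K`).

CONCLUSION (`RowC3.bsdp_of_indexLowerBoundAt_of_mainConjectures`): for every `(E,p)` in row C3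
(`r_an = 1`, semistable, good `p`, `E[p]` irreducible) with `p ≥ 5` good ORDINARY and `p ∤ ∏ c_ℓ(E)`,
`BSD(E,p)` follows from the PUBLISHED named facts of the tree (Gross–Zagier, Kolyvagin ×2,
Skinner–Urban 2014 Thm. 3.6.9 cl. 3 AS TYPED (`skinner_urban_main_conjecture`, bsd.S21), Greenberg
1999 Thm. 4.1, Wuthrich 2014 Lemma 20, the period units, Gross–Zagier–Kolyvagin over `ℚ`, modularity
×3, Friedberg–Hoffstein, Mazur 1978 Cor. 4.1, the Néron mapping property, JSW §7.4's Ribet remark)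
and ONE typed input: STEP L (`X11b.IndexLowerBoundAt`, JSW (eq:shalowerK-1) = "one divisibility of
the anticyclotomic main conjecture + anticyclotomic control + BDP formula") at every Manin-unit
Heegner datum over a field with every `ℓ ∣ N` split and `p` split. CAVEAT ON PRINT (checked against
pp. 26, 29–30 of arXiv:1512.06894): JSW prove (eq:shalowerK-1) — §7.4.1 with §6.2 Prop. (Lpf1=Sel)
(Prop. 38 in the numbering of the held text) from Wan's theorem (§6.1, Thm. 34 there) — for an
auxiliary `K′` satisfying (gen-H) together with "at least one prime divisor of `N` non-split in `K`"
(their condition (b): the (ram) prime `q` inert or ramified in `K′`), whereas the tree's STEP-L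
currency (`X11b/BDPRoute.lean`) and this binder read the inequality for a `K` in which EVERY `ℓ ∣ N`
splits (classical Heegner point on `X₀(N)`); for such `K` the lower bound at a good ordinary `p` is
NOT in print from JSW/Wan (it would come from classical-Heegner anticyclotomic results —
Perrin-Riou's Heegner point main conjecture (Burungale–Castella–Kim 2021) + control — none vendored
in this currency). So `hL` is a genuinely TYPED input here, exactly as at `p ∥ N`, and the row-C3
entry "covered by JSW Thm. 1.2.1" of RESIDUAL-CASES points, on the ordinary `p ∤ ∏ c_ℓ` part of its
locus, at a kernel object whose every input OTHER than STEP L is a cited named fact. The supersingular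
sub-case of C3 (flag `JSW-ss`) and the pairs with `p ∣ ∏ c_ℓ` are NOT touched (the typed STEP-L
currency `IndexLowerBoundAt` carries `p ∤ ∏ c_ℓ` through Kolyvagin's index bound). Nothing here
deletes a class or moves a label; C3 is COVERED by JSW Thm. 1.2.1 itself (`RowC3.bsdp`).

References: Jetchev–Skinner–Wan 2017 §7.3.1 (eq:tamK), §7.4 (Ribet remark), §7.4.1 (pp. 29–31)
[JetchevSkinnerWan2017]; Skinner–Urban 2014 Thm. 3.6.9 [SkinnerUrban2014]; Greenberg LNM 1716 Thm. 4.1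
[GreenbergLNM1716]; Knapp 1993 Prop. 12.10 [Knapp1993]; Silverman AEC VII.1 Prop. 1.3(b), VII.5
Prop. 5.1(a), VIII.8 Cor. 8.3, X.5 Cor. 5.4 [SilvermanAEC2009]; Mazur 1978 Cor. 4.1 [Mazur1978];
Friedberg–Hoffstein 1995 [FriedbergHoffstein1995]; Ribet 1990 Thm. 1.1 [Ribet1990]; Miller 2011
Def. 1.1 [Miller2011LMS].
-/

set_option autoImplicit false

noncomputable section

open scoped Classical MatrixGroups ModularForm

open CongruenceSubgroup WeierstrassCurve NumberField Literature.NumberTheory.EllipticCurves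
  Literature.NumberTheory.EllipticCurves.ModularForms
  Literature.NumberTheory.EllipticCurves.Rank1Residual

namespace Summit.BirchSwinnertonDyer.Rank1Residual

namespace X11b

/-! ### The two transports multr1 proved only at a multiplicative `p`, now at a good `p` -/

/-- **Every globally minimal model of `E^{(d_K)}` is good ordinary at a good ordinary odd prime
`p ∤ d_K` of `E`.** For `K` quadratic, `d_K` is a fundamental discriminant (tree
`Quadratic.isFundamentalDiscriminant_discr`: `d_K ≡ 1 (mod 4)` squarefree, or `d_K = 4m` with `m`
squarefree); in the second case `W^{(4m)} = W^{(m · 2²)} ≅ W^{(m)}` over `ℚ`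
(`exists_variableChange_quadraticTwist_mul_sq`), so in both cases `Wd` is a globally minimal model of
the twist by a squarefree `d` with `p ∤ 2d`, and the tree's `isOrdinaryAt_of_smul_eq_quadraticTwist`
(good reduction of the twisted equation at `p`, `a_p(E^{(d)}) = (d/p) a_p(E)`; Knapp, *Elliptic
Curves*, Prop. 12.10) applies. [cite: Knapp1993, Prop. 12.10]
[cite: SilvermanAEC2009, VII.5 Prop. 5.1(a) and X.5 Cor. 5.4] -/
theorem goodOrd_twist_model (W : WeierstrassCurve ℚ) [W.IsElliptic] [W.IsGloballyMinimal]
    (p : ℕ) [Fact p.Prime] (K : Type) [Field K] [NumberField K] (h2 : Module.finrank ℚ K = 2)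
    (hp2 : p ≠ 2) (hpd : ¬ (p : ℤ) ∣ NumberField.discr K) (hord : GoodOrd W p)
    {Wd : WeierstrassCurve ℚ} [Wd.IsGloballyMinimal] (Cd : VariableChange ℚ)
    (hWd : Cd • W.quadraticTwist (NumberField.discr K : ℚ) = Wd) : GoodOrd Wd p := by
  have hW : IsOrdinaryAt W p := ⟨hord.1, hord.2⟩
  suffices h : IsOrdinaryAt Wd p from ⟨h.1, h.2⟩
  rcases Literature.NumberTheory.QuadraticFields.Quadratic.isFundamentalDiscriminant_discr
      (K := K) h2 with ⟨-, hsq, -⟩ | ⟨h4, -, hsq⟩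
  · -- `d_K ≡ 1 (mod 4)` is squarefree
    have hC : Cd⁻¹ • Wd = W.quadraticTwist (NumberField.discr K : ℚ) := by
      rw [← hWd, inv_smul_smul]
    exact isOrdinaryAt_of_smul_eq_quadraticTwist W Wd hsq hC p hp2 hpd hW
  · -- `d_K = 4m` with `m` squarefree: `W^{(4m)} ≅ W^{(m)}` over `ℚ`
    obtain ⟨m, hm⟩ := h4
    have hm4 : NumberField.discr K / 4 = m := by
      rw [hm, Int.mul_ediv_cancel_left m (by norm_num)]
    rw [hm4] at hsq
    have hpm : ¬ (p : ℤ) ∣ m := fun h ↦ hpd (hm ▸ h.mul_left 4)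
    obtain ⟨C₁, hC₁⟩ := W.exists_variableChange_quadraticTwist_mul_sq (m : ℚ) 2 two_ne_zero
    have hcast : (NumberField.discr K : ℚ) = (m : ℚ) * 2 ^ 2 := by
      rw [hm]; push_cast; ring
    have hC : (Cd * C₁)⁻¹ • Wd = W.quadraticTwist (m : ℚ) := by
      rw [← hWd, hcast, ← hC₁, ← mul_smul Cd C₁, inv_smul_smul]
    exact isOrdinaryAt_of_smul_eq_quadraticTwist W Wd hsq hC p hp2 hpm hW

/-- **The side condition `ord_p u = 0` at a GOOD prime `p ∤ d`.** Let `W/ℚ` and `Wd/ℚ` be globally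
minimal and elliptic with good reduction at `p`, `Wd = Cd • W^{(d)}` with `d ∈ ℤ`, `p ∤ d`. Then
`ord_p u(Cd) = 0`: both minimal discriminants are `p`-units (Silverman, *AEC* VII.5 Prop. 5.1(a);
tree `not_dvd_minimalDiscriminantInt_of_hasGoodReductionAtPrime'`), and
`Δ(Wd) = u⁻¹² d⁶ Δ(W)` (`variableChange_Δ`, `quadraticTwist_Δ`), whence `12 · ord_p u = 0`. (At a
multiplicative `p` this is multr1's `padicValRat_u_eq_zero_of_twist_minimal`, which needs the
`ℚ_p`-isomorphism `E^{(d_K)} ≅ E`; at a good `p` the discriminants alone decide.)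
[cite: SilvermanAEC2009, VII.5 Prop. 5.1(a) and VII.1 Prop. 1.3(b)] -/
theorem padicValRat_u_eq_zero_of_twist_good (W : WeierstrassCurve ℚ) [W.IsElliptic]
    [W.IsGloballyMinimal] (p : ℕ) [Fact p.Prime] {d : ℤ} (hpd : ¬ (p : ℤ) ∣ d)
    (hgood : W.HasGoodReductionAtPrime p) {Wd : WeierstrassCurve ℚ} [Wd.IsElliptic]
    [Wd.IsGloballyMinimal] (Cd : VariableChange ℚ) (hWd : Cd • W.quadraticTwist (d : ℚ) = Wd)
    (hgoodd : Wd.HasGoodReductionAtPrime p) : padicValRat p (Cd.u : ℚ) = 0 := by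
  have hd0 : (d : ℚ) ≠ 0 := by
    have : d ≠ 0 := fun h ↦ hpd (h ▸ dvd_zero _)
    exact_mod_cast this
  have hu0 : (Cd.u : ℚ) ≠ 0 := Cd.u.ne_zero
  have hΔW0 : W.Δ ≠ 0 := W.isUnit_Δ.ne_zero
  -- both minimal discriminants are `p`-units, and `p ∤ d`
  have hvW : padicValRat p W.Δ = 0 := by
    rw [← cast_minimalDiscriminantInt, padicValRat.of_int, padicValInt.eq_zero_of_not_dvd
      (W.not_dvd_minimalDiscriminantInt_of_hasGoodReductionAtPrime' p hgood), Nat.cast_zero]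
  have hvd : padicValRat p Wd.Δ = 0 := by
    rw [← cast_minimalDiscriminantInt, padicValRat.of_int, padicValInt.eq_zero_of_not_dvd
      (Wd.not_dvd_minimalDiscriminantInt_of_hasGoodReductionAtPrime' p hgoodd), Nat.cast_zero]
  have hvdd : padicValRat p (d : ℚ) = 0 := by
    rw [padicValRat.of_int, padicValInt.eq_zero_of_not_dvd hpd, Nat.cast_zero]
  -- `Δ(Wd) = u⁻¹² d⁶ Δ(W)`
  have hΔ : Wd.Δ = ((Cd.u : ℚ)⁻¹) ^ 12 * ((d : ℚ) ^ 6 * W.Δ) := by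
    rw [← hWd, variableChange_Δ, quadraticTwist_Δ, Units.val_inv_eq_inv_val]
  have h := congrArg (padicValRat p) hΔ
  rw [hvd, padicValRat.mul (pow_ne_zero _ (inv_ne_zero hu0))
      (mul_ne_zero (pow_ne_zero _ hd0) hΔW0), padicValRat.pow, padicValRat.inv,
    padicValRat.mul (pow_ne_zero _ hd0) hΔW0, padicValRat.pow, hvdd, hvW] at h
  push_cast at h
  linarith

/-! ### The Manin-unit Heegner datum at a good prime -/

/-- **The Manin-unit Heegner datum at a GOOD odd prime** (the binder `hMan` of the multr1 chain,
discharged at `p ∤ N`). For every globally minimal elliptic `W/ℚ` of conductor `N`, odd prime `p` of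
good reduction (so `p ∤ N`, a fortiori `p² ∤ N`) with `E[p]` irreducible, and imaginary quadratic `K`
satisfying the Heegner hypothesis for `N`: a datum `Dt` of `W` at level `N` with `p ∤ c`
(`exists_modularParametrizationData_not_dvd`: modularity, Mazur 1978 Cor. 4.1, the Néron mapping
property), a Heegner datum `H` of discriminant `d_K`, an embedding `ι : K → ℂ`, and a point
`P ∈ E(K)` mapping to the Heegner point (Gross 1984 §I.1, Darmon 2004 Thm. 3.6 — the tree theorems
used by multr1's `exists_maninDatum`, whose only use of multiplicative reduction was `p² ∤ N`).
[cite: Mazur1978, Cor. 4.1] [cite: Darmon2004, Thm. 3.6 and §3.7]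
[cite: JetchevSkinnerWan2017, §7.4.1 (p. 30) and Remark 43] -/
theorem exists_maninDatum_of_good (hnf : exists_isNewformOf)
    (hMaz : mazur_not_dvd_maninConstant_of_odd) (hNS : integral_neronScaling_of_isGloballyMinimal)
    (W : WeierstrassCurve ℚ) [W.IsElliptic] [W.IsGloballyMinimal] (p : ℕ) [Fact p.Prime]
    (N : ℕ) [NeZero N] (K : Type) [Field K] [NumberField K] (hN : W.conductorNorm ℤ = N)
    (hp2 : p ≠ 2) (hgood : W.HasGoodReductionAtPrime p) (hirr : W.HasIrreducibleModPGaloisRep p)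
    (hK : IsImaginaryQuadratic K) (hH : SatisfiesHeegnerHypothesis N K) :
    ∃ (Dt : ModularParametrizationData W N) (H : HeegnerDatum N (NumberField.discr K))
      (ι : K →+* ℂ) (P : (W.baseChange K).toAffine.Point),
      WeierstrassCurve.Affine.Point.map ι.toRatAlgHom P = heegnerPointComplex Dt H ∧
        ¬ (p : ℤ) ∣ Dt.c := by
  have hp : p.Prime := Fact.out
  have hpN' : ¬ p ∣ W.conductorNorm ℤ := fun h ↦
    (W.dvd_conductorNorm_iff_not_hasGoodReductionAtPrime p).mp h hgood
  have hpN : ¬ p ^ 2 ∣ N := fun h ↦ hpN' (hN ▸ (dvd_pow_self p two_ne_zero).trans h)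
  obtain ⟨Dt, hDt⟩ := exists_modularParametrizationData_not_dvd hnf hMaz hNS W hN hp hp2 hpN hirr
  obtain ⟨β, hβ⟩ := exists_dvd_sq_sub_discr_holds N K hK hH
  obtain ⟨H, -⟩ := nonempty_heegnerDatum_holds N K hK hβ
  obtain ⟨ι⟩ : Nonempty (K →+* ℂ) := inferInstance
  obtain ⟨P, hP⟩ := heegnerPointComplex_mem_range_map_holds N W K hK hH Dt H ι
  exact ⟨Dt, H, ι, P, hP, hDt⟩

end X11b

/-! ### Row C3 at class level -/

/-- **Row C3 (Jetchev–Skinner–Wan 2017 Thm. 1.2.1), ordinary part with `p ∤ ∏ c_ℓ`, at CLASS level: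
STEP L (typed) + the cyclotomic main conjecture of the twist (Skinner–Urban, typed) + Gross–Zagier +
Kolyvagin ⇒ `BSD(E,p)`.** For every `(E,p)` with `r_an(E) = 1`, `E` semistable, `p ≥ 5` a prime of
good ORDINARY reduction, `E[p]` irreducible and `p ∤ ∏_ℓ c_ℓ(E)`: Miller's `BSD(E,p)` — from the
PUBLISHED named facts of the tree (binders `hGZ` … `hRib`) and the ONE typed input `hL`: STEP L
(`X11b.IndexLowerBoundAt`, JSW (eq:shalowerK-1): one divisibility of the anticyclotomic main
conjecture + anticyclotomic control + the BDP formula; in print (JSW 2017 §7.4.1 and §6.2 Prop.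
(Lpf1=Sel), from Wan) only for `K` with some `q ∣ N` NON-split — for the all-split `K` of this binder
a typed input with no vendored source, see the module docstring's CAVEAT) at every Manin-unit Heegner
datum of every such pair over an imaginary quadratic field with every `ℓ ∣ N` split and `p` split.
Proof = JSW §7.4.1 as formalised by multr1 + this cell: `w(E) = −1` (modularity); `K` by
Friedberg–Hoffstein (`hFH`; `|d_K| > 4`, so `#𝓞_K^× = 2`); (ram) for `E` by Ribet (`hRib`); the
Manin-unit datum (`X11b.exists_maninDatum_of_good`); a global minimal model of `E^{(d_K)}` (Néron)
with (irr), (ram), the Tamagawa `p`-part, good ordinary reduction and the unit side condition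
transported (`X11b.hasIrreducibleModPGaloisRep_twist_model`, `X11b.ram_twist_of_heegner`,
`X11b.padicValNat_tamagawaProduct_twist_of_heegner`, `X11b.goodOrd_twist_model`,
`X11b.padicValRat_u_eq_zero_of_twist_good`); then
`X11b.bsdp_rankOne_of_indexLowerBoundAt_of_goodOrd_twist` (STEP L + Kolyvagin ⇒ the index identity
over `K`; Gross–Zagier; the twist's rank-`0` `p`-part from Skinner–Urban's main conjecture AS TYPED +
Greenberg + Wuthrich + the period unit; descent). CONDITIONAL on STEP L only; row C3 is COVERED in
print by JSW Thm. 1.2.1 itself (`RowC3.bsdp`); no label moves.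
[cite: JetchevSkinnerWan2017, Thm. 1.2.1 and §7.4–7.4.1 (pp. 29–31)]
[cite: SkinnerUrban2014, Thm. 3.6.9 and p. 46] [cite: GreenbergLNM1716, Thm. 4.1]
[cite: KolyvaginEulerSystems1990, Thm. A] [cite: GrossZagier1986, Thm. V.2.1]
[cite: Miller2011LMS, Def. 1.1] -/
theorem RowC3.bsdp_of_indexLowerBoundAt_of_mainConjectures
    -- published inputs (named facts of the tree)
    (hGZ : ∀ (N : ℕ) [NeZero N] (W : WeierstrassCurve ℚ) (K : Type) [Field K] [NumberField K],
      gross_zagier N W K)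
    (hKo : ∀ (N : ℕ) [NeZero N] (W : WeierstrassCurve ℚ) (K : Type) [Field K] [NumberField K],
      kolyvagin N W K)
    (hB : ∀ (N : ℕ) [NeZero N] (W : WeierstrassCurve ℚ) (K : Type) [Field K] [NumberField K],
      Kolyvagin1990_padicValNat_card_sha_le N W K)
    (hSU : ∀ (W : WeierstrassCurve ℚ) [W.IsElliptic] [W.IsGloballyMinimal] (p : ℕ) [Fact p.Prime]
      (κ : ZpExtension ℚ p) (γ : Field.absoluteGaloisGroup ℚ) (N : ℕ) [NeZero N]
      (f : CuspForm (Gamma0 N) 2),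
      skinner_urban_main_conjecture W p (κ := κ) (γ := γ) (f := f))
    (hGr : greenberg_charValue_rankZero)
    (hW3 : Wuthrich2014.lemma20_surjective_threeAdic_of_semistable)
    (h5 : realPeriodRat_eq_unit_mul_plusPeriod) (h3 : realPeriodRat_eq_unit_mul_plusPeriod_three)
    (hGZK : rank_eq_analyticRank_of_analyticRank_le_one) (hmod : hasEntireLFunction_rat)
    (hpar : nonempty_modularParametrizationData) (hnf : exists_isNewformOf)
    (hFH : friedbergHoffstein_exists_heegnerField_split_twist_ne_zero)
    (hMaz : mazur_not_dvd_maninConstant_of_odd) (hNS : integral_neronScaling_of_isGloballyMinimal)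
    (hRib : JetchevSkinnerWan2017.sec74_exists_ramifiedPrime_of_semistable)
    -- the typed input (STEP L) at every Manin-unit Heegner datum, `p` split in `K`
    (hL : ∀ (W : WeierstrassCurve ℚ) [W.IsElliptic] [W.IsGloballyMinimal] (p : ℕ) [Fact p.Prime]
      (N : ℕ) [NeZero N] (K : Type) [Field K] [NumberField K]
      (Dt : ModularParametrizationData W N) (H : HeegnerDatum N (NumberField.discr K)) (ι : K →+* ℂ)
      (P : (W.baseChange K).toAffine.Point),
      RowC3 W p → GoodOrd W p → 5 ≤ p → ¬ p ∣ W.tamagawaProduct → W.conductorNorm ℤ = N →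
      IsImaginaryQuadratic K → SatisfiesHeegnerHypothesis N K → SatisfiesHeegnerHypothesis p K →
      WeierstrassCurve.Affine.Point.map ι.toRatAlgHom P = heegnerPointComplex Dt H →
      ¬ (p : ℤ) ∣ Dt.c → X11b.IndexLowerBoundAt W p K P)
    -- the pair
    (W : WeierstrassCurve ℚ) [W.IsElliptic] [W.IsGloballyMinimal] (p : ℕ) [Fact p.Prime]
    (h : RowC3 W p) (hord : GoodOrd W p) (hp5 : 5 ≤ p) (htam0 : ¬ p ∣ W.tamagawaProduct) :
    BSDp W p := by
  obtain ⟨hr, hsst, hgood, hirr, -⟩ := h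
  have hp : p.Prime := Fact.out
  have hp2 : p ≠ 2 := by omega
  -- (ram) for `E`: Ribet's level lowering (JSW §7.4)
  have hram : Ram W p :=
    JetchevSkinnerWan2017.ram_of_sec74_of_five_le hRib W p hp5 hsst hgood hirr hr
  haveI : NeZero (W.conductorNorm ℤ) := ⟨(W.conductorNorm_pos_holds).ne'⟩
  -- the sign of the functional equation is `−1` (modularity, `r_an = 1`)
  have hw : W.rootNumber = -1 := by
    rw [WeierstrassCurve.rootNumber_eq_neg_one_pow_analyticRank_of_exists_isNewformOf hnf W, hr]
    norm_num
  -- the auxiliary field (Friedberg–Hoffstein): every `ℓ ∣ N` split, `p` split, `|d_K| > 4`,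
  -- `L(E^{d_K},1) ≠ 0`
  obtain ⟨K, _, _, hK, hdisc, hHN, hHp, hLt⟩ := hFH W hw p hp 4
  -- `w_K = 2`, prime to `p ≥ 5`
  have hμ : ¬ p ∣ Units.torsionOrder K := by
    haveI : IsTotallyComplex K := hK.2
    have hneg : NumberField.discr K < 0 := IsImaginaryQuadratic.discr_neg hK
    have habs : ((NumberField.discr K).natAbs : ℤ) = -NumberField.discr K :=
      Int.ofNat_natAbs_of_nonpos hneg.le
    have h4 : NumberField.discr K < -4 := by
      have : (4 : ℤ) < ((NumberField.discr K).natAbs : ℤ) := by exact_mod_cast hdisc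
      omega
    rw [Literature.NumberTheory.DiophantineGeometry.torsionOrder_eq_two_of_discr_lt hK.1 h4]
    intro h2
    have := Nat.le_of_dvd two_pos h2
    omega
  -- `p ∤ d_K` (`p` splits in `K`)
  have hpd : ¬ (p : ℤ) ∣ NumberField.discr K :=
    Literature.SatisfiesHeegnerHypothesis.not_dvd_discr hK.1 hHp hp dvd_rfl
  -- the Manin-unit Heegner datum
  obtain ⟨Dt, H, ι, P, hP, hc⟩ :=
    X11b.exists_maninDatum_of_good hnf hMaz hNS W p (W.conductorNorm ℤ) K rfl hp2 hgood hirr hK hHN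
  -- a globally minimal model of the twist (Néron; Silverman VIII.8 Cor. 8.3) and the transports
  have hD0 : (NumberField.discr K : ℚ) ≠ 0 := by exact_mod_cast NumberField.discr_ne_zero K
  haveI hEt : (W.quadraticTwist (NumberField.discr K : ℚ)).IsElliptic :=
    W.isElliptic_quadraticTwist hD0
  obtain ⟨Cd, hCd⟩ := hasGlobalMinimalModel_rat_holds (W.quadraticTwist (NumberField.discr K : ℚ))
  haveI : (Cd • W.quadraticTwist (NumberField.discr K : ℚ)).IsGloballyMinimal := hCd
  have hWd : Cd • W.quadraticTwist (NumberField.discr K : ℚ) =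
      Cd • W.quadraticTwist (NumberField.discr K : ℚ) := rfl
  have hirrd : Irr (Cd • W.quadraticTwist (NumberField.discr K : ℚ)) p :=
    X11b.hasIrreducibleModPGaloisRep_twist_model W p K hK.1 hirr Cd hWd
  have hramd : Ram (Cd • W.quadraticTwist (NumberField.discr K : ℚ)) p :=
    X11b.ram_twist_of_heegner W p K hK hHN hram Cd hWd
  have htam : padicValNat p (Cd • W.quadraticTwist (NumberField.discr K : ℚ)).tamagawaProduct =
      padicValNat p W.tamagawaProduct :=
    X11b.padicValNat_tamagawaProduct_twist_of_heegner W p hp5 K hK hHN Cd hWd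
  have hordd : GoodOrd (Cd • W.quadraticTwist (NumberField.discr K : ℚ)) p :=
    X11b.goodOrd_twist_model W p K hK.1 hp2 hpd hord Cd hWd
  have hu : padicValRat p (Cd.u : ℚ) = 0 :=
    X11b.padicValRat_u_eq_zero_of_twist_good W p hpd hgood Cd hWd hordd.1
  exact X11b.bsdp_rankOne_of_indexLowerBoundAt_of_goodOrd_twist W p (W.conductorNorm ℤ) K Dt H ι P
    (hGZ _ W K) (hKo _ W K) (hB _ W K) hSU hGr hW3 h5 h3 hGZK hmod hpar hr hp5 hirr hram htam0
    hK hHN hP hc hμ hLt (Cd • W.quadraticTwist (NumberField.discr K : ℚ)) Cd hWd hordd hirrd hramd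
    htam hu (hL W p _ K Dt H ι P ⟨hr, hsst, hgood, hirr, Or.inl hp5⟩ hord hp5 htam0 rfl hK hHN hHp
      hP hc)

end Summit.BirchSwinnertonDyer.Rank1Residual

end
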